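import Summits.NavierStokesRegularity.NavierStokesRegularity.Theses.FlatSwirlGauge
import Literature.Analysis.FluidPDE.FlatSwirlGaugeChart
import Literature.Analysis.FluidPDE.VorticityCalculus

/-!
# `FlatGaugeAtSingularity` (stmt-NavierStokesRegularity-1252): the kinematic obstruction to a flat swirl gauge

Negative-side support for the crux `FlatGaugeAtSingularity` (FG) of route `FlatSwirlGauge`, written by the
line lead of its registered line (cut FG ⟺ K ∧ D, K = `stub_vortexChartAtSingularity` = "a bounded `C²`
first integral `α` of the vorticity, nondegenerate off an axis-like thin set, exists on a fixed backward
cylinder at the singular point"). The crux's own `why it might fail` is "chaotic (ABC-type) vortex lines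
admit no such `α` (DombreEtAl1986; ArnoldKhesin1998 Ch. II)". This file makes that sentence a theorem, in
the weakest dynamical currency that kills the chart — ONE vortex line dense in an open sub-ball:

* `firstIntegral_eq_on_of_dense_orbit` — pure kinematics on a real inner product space: if `a` is
  differentiable on an open set `U`, `⟪V, ∇a⟫ = 0` on `U`, and an integral curve `γ` of `V` stays in `U`
  with `U ⊆ closure (range γ)`, then `a` is constant on `U` (chain rule: `(a ∘ γ)' = ⟪∇a, V⟫ ∘ γ = 0`;
  density + continuity), hence `∇a = 0` on `U` (`gradient_eq_zero_of_eqOn_const`).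
* `not_isVortexChartOn_of_dense_vortexLine` / `not_isFlatSwirlGaugeOn_of_dense_vortexLine` —
  consequently NO kinematic vortex chart (`Literature.Analysis.FluidPDE.IsVortexChartOn`, the object of
  stub K; only the clauses `α ∈ C²`, `⟪curl u, ∇α⟫ = 0`, `‖curl u‖ d ≤ C₀‖∇α‖` where `d > 0`, and the
  volume clause are used), hence no flat swirl gauge, lives on a cylinder `Q_ρ(T, x₀)` one of whose time slices `t` carries a vortex
  line `γ` (`γ' = curl (u t) ∘ γ`) confined to and dense in an open `U ⊆ B_ρ(x₀)` together with an open
  nonempty `W ⊆ U` on which `curl (u t) ≠ 0`: on `U` the momentum `α(t, ·)` is constant, so `∇α = 0`; on `W`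
  chart nondegeneracy then forces `d ≤ 0`; so `W ⊆ {d < δ} ∩ B_ρ` for every `δ ∈ (0, ρ)` and
  `0 < vol W ≤ C₀ δ² ρ → 0` — contradiction.
* `not_hasFlatSwirlGauge_of_dense_vortexLines` — if this happens inside EVERY backward cylinder at
  `(T, x₀)` (some time slice of each `Q_ρ(T, x₀)` has such a dense vortex line), `u` has no flat swirl gauge
  at `(T, x₀)`.
* `flatGaugeAtSingularity_false_of_denseVortexLines` — hence FG is FALSE as soon as ONE Leray–Hopf
  classical solution from a decaying datum blows up at some `(T, x₀)` with vortex lines dense in open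
  subsets of `B_ρ(x₀)` (not consisting of stagnation points of `ω`) at a sequence of times and scales
  shrinking to `(T, x₀)` (hypothesis `DenseVortexLinesAtSingularity`, written inline; the open set `W` is
  produced from one non-stagnation point by continuity of the classical vorticity, `continuous_curl`). The hypothesis is not constructible today (it contains
  a finite-time blow-up), so this is a NEGATIVE-MODULO lemma, not a refutation: it says exactly which
  vortex-line topology any proof of K (and of FG) must exclude at every singularity — persistent
  topological transitivity of the frozen-time vortex-line flow in sub-balls down to the singular point.

Only Mathlib calculus/measure theory, `continuous_curl` and the landed definition files
`Literature/Analysis/FluidPDE/FlatSwirlGauge.lean`, `FlatSwirlGaugeChart.lean` are used; nothing is assumed.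
-/

-- the problem namespace `Summit.NavierStokesRegularity.NavierStokesRegularity` repeats the summit name by design (D-0017)
set_option linter.dupNamespace false

noncomputable section

open Set MeasureTheory Metric Function Filter
open scoped RealInnerProductSpace ENNReal Topology
open Literature.Analysis.FluidPDE
open Summit.NavierStokesRegularity.NavierStokesRegularity.Theses.FlatSwirlGauge

namespace Summit.NavierStokesRegularity.NavierStokesRegularity.Theorems.FlatGaugeAtSingularity.Negative

/-- Local notation for physical space `ℝ³ = EuclideanSpace ℝ (Fin 3)`. -/
local notation "ℝ³" => EuclideanSpace ℝ (Fin 3)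

/-! ### Pure kinematics: a first integral is constant along a dense orbit -/

section Kinematics

variable {E : Type*} [NormedAddCommGroup E] [InnerProductSpace ℝ E] [CompleteSpace E]
  {V : E → E} {a : E → ℝ} {U : Set E} {γ : ℝ → E}

/-- **A first integral is constant along an integral curve.** If `a` is differentiable on an open set `U`,
`⟪V, ∇a⟫ = 0` on `U`, and `γ` is an integral curve of `V` (`γ' = V ∘ γ`) staying in `U`, then `a ∘ γ` is
constant: `(a ∘ γ)'(s) = Da(γ s)[V(γ s)] = ⟪∇a(γ s), V(γ s)⟫ = 0`. [folklore] -/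
theorem firstIntegral_comp_eq (hU : IsOpen U) (ha : DifferentiableOn ℝ a U)
    (hVa : ∀ x ∈ U, ⟪V x, gradient a x⟫ = 0) (hγ : ∀ s, HasDerivAt γ (V (γ s)) s)
    (hγU : ∀ s, γ s ∈ U) (s₁ s₂ : ℝ) : a (γ s₁) = a (γ s₂) := by
  have hd : ∀ s, HasDerivAt (a ∘ γ) 0 s := by
    intro s
    have h1 : HasFDerivAt a (fderiv ℝ a (γ s)) (γ s) :=
      ((ha (γ s) (hγU s)).differentiableAt (hU.mem_nhds (hγU s))).hasFDerivAt
    have h2 := h1.comp_hasDerivAt s (hγ s)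
    have h3 : fderiv ℝ a (γ s) (V (γ s)) = 0 := by
      have h4 := hVa (γ s) (hγU s)
      rwa [real_inner_comm, gradient, InnerProductSpace.toDual_symm_apply] at h4
    rwa [h3] at h2
  exact is_const_of_deriv_eq_zero (fun s => (hd s).differentiableAt) (fun s => (hd s).deriv) s₁ s₂

/-- **A first integral is constant on the closure of a dense orbit.** Under the hypotheses of
`firstIntegral_comp_eq`, if moreover `U ⊆ closure (range γ)` then `a = a (γ 0)` on `U` (continuity of `a`
on the open set `U`). [folklore] -/
theorem firstIntegral_eq_on_of_dense_orbit (hU : IsOpen U) (ha : DifferentiableOn ℝ a U)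
    (hVa : ∀ x ∈ U, ⟪V x, gradient a x⟫ = 0) (hγ : ∀ s, HasDerivAt γ (V (γ s)) s)
    (hγU : ∀ s, γ s ∈ U) (hdense : U ⊆ closure (range γ)) {x : E} (hx : x ∈ U) :
    a x = a (γ 0) := by
  obtain ⟨v, hv, hvx⟩ := mem_closure_iff_seq_limit.1 (hdense hx)
  have hconst : ∀ n, a (v n) = a (γ 0) := by
    intro n
    obtain ⟨s, hs⟩ := hv n
    rw [← hs]
    exact firstIntegral_comp_eq hU ha hVa hγ hγU s 0
  have hcont : ContinuousAt a x := (ha.continuousOn.continuousWithinAt hx).continuousAt (hU.mem_nhds hx)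
  have h1 : Tendsto (fun n => a (v n)) atTop (𝓝 (a x)) := hcont.tendsto.comp hvx
  have h2 : Tendsto (fun n => a (v n)) atTop (𝓝 (a (γ 0))) := by
    simp only [hconst]
    exact tendsto_const_nhds
  exact tendsto_nhds_unique h1 h2

/-- A function constant on an open set has vanishing gradient there. [folklore] -/
theorem gradient_eq_zero_of_eqOn_const (hU : IsOpen U) {c : ℝ} (hc : ∀ x ∈ U, a x = c) {x : E}
    (hx : x ∈ U) : gradient a x = 0 := by
  have h : a =ᶠ[𝓝 x] fun _ => c :=
    Filter.eventually_of_mem (hU.mem_nhds hx) fun y hy => hc y hy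
  rw [h.gradient_eq, gradient_fun_const]

end Kinematics

/-! ### No flat swirl gauge on a cylinder with a dense vortex line in a time slice -/

section Gauge

variable {ν T ρ C₀ M : ℝ} {u : ℝ → ℝ³ → ℝ³} {x₀ : ℝ³} {α : ℝ → ℝ³ → ℝ} {b : ℝ → ℝ³ → ℝ³}
  {d : ℝ → ℝ³ → ℝ}

/-- The momentum of a kinematic vortex chart is differentiable on the ball in each time slice (slice of
the `C²` clause). [folklore] -/
theorem differentiableOn_slice (h : IsVortexChartOn u T x₀ ρ C₀ M α d) {t : ℝ}
    (ht : t ∈ Ioo (T - ρ ^ 2) T) : DifferentiableOn ℝ (α t) (ball x₀ ρ) := by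
  have hcd := h.2.2.1
  have hcomp : ContDiffOn ℝ 2 (uncurry α ∘ fun x : ℝ³ => (t, x)) (ball x₀ ρ) :=
    hcd.comp (contDiffOn_const.prodMk contDiffOn_id) fun x hx => mk_mem_prod ht hx
  have : ContDiffOn ℝ 2 (α t) (ball x₀ ρ) := by
    simpa [Function.comp_def] using hcomp
  exact this.differentiableOn (by norm_num)

/-- **A dense vortex line in one time slice kills every kinematic vortex chart on the cylinder** (stub K
of the registered line, `IsVortexChartOn` of `Literature/Analysis/FluidPDE/FlatSwirlGaugeChart.lean`).
Let `(α, d, C₀, M)` be a kinematic vortex chart for `u` on `Q_ρ(T, x₀)`, `t ∈ (T − ρ², T)`, `U ⊆ B_ρ(x₀)`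
open, `γ` an integral curve of `curl (u t)` confined to `U` and dense in `U`, and `W ⊆ U` open nonempty
with `curl (u t) ≠ 0` on `W`. Contradiction: `α(t,·)` is constant on `U`
(`firstIntegral_eq_on_of_dense_orbit` with the first-integral clause `⟪curl u, ∇α⟫ = 0`), so
`∇α(t,·) = 0` on `U`; on `W` chart nondegeneracy `‖curl u‖ d ≤ C₀ ‖∇α‖ = 0` forces `d ≤ 0`; hence
`W ⊆ {d(t,·) < δ} ∩ B_ρ` and `vol W ≤ C₀ δ² ρ` for every `δ ∈ (0, ρ)`, so `vol W = 0` (`δ → 0⁺`), while an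
open nonempty set has positive volume. [folklore] -/
theorem not_isVortexChartOn_of_dense_vortexLine {t : ℝ} (ht : t ∈ Ioo (T - ρ ^ 2) T)
    {U : Set ℝ³} (hU : IsOpen U) (hUB : U ⊆ ball x₀ ρ) {γ : ℝ → ℝ³}
    (hγ : ∀ s, HasDerivAt γ (curl (u t) (γ s)) s) (hγU : ∀ s, γ s ∈ U)
    (hdense : U ⊆ closure (range γ)) {W : Set ℝ³} (hW : IsOpen W) (hWne : W.Nonempty) (hWU : W ⊆ U)
    (hcurl : ∀ x ∈ W, curl (u t) x ≠ 0) : ¬ IsVortexChartOn u T x₀ ρ C₀ M α d := by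
  intro h
  -- `α(t, ·)` is constant on `U`, hence `∇α(t, ·) = 0` there
  have hdiff : DifferentiableOn ℝ (α t) U := (differentiableOn_slice h ht).mono hUB
  have hVa : ∀ x ∈ U, ⟪curl (u t) x, gradient (α t) x⟫ = 0 :=
    fun x hx => (h.2.2.2.2 t ht x (hUB hx)).2.1
  have hconst : ∀ x ∈ U, α t x = α t (γ 0) :=
    fun x hx => firstIntegral_eq_on_of_dense_orbit hU hdiff hVa hγ hγU hdense hx
  have hgrad : ∀ x ∈ U, gradient (α t) x = 0 :=
    fun x hx => gradient_eq_zero_of_eqOn_const hU hconst hx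
  -- on `W`, chart nondegeneracy forces `d ≤ 0`
  have hd : ∀ x ∈ W, d t x ≤ 0 := by
    intro x hx
    by_contra hdx
    push Not at hdx
    have h1 := (h.2.2.2.2 t ht x (hUB (hWU hx))).2.2 hdx
    rw [hgrad x (hWU hx), norm_zero, mul_zero] at h1
    have h2 : 0 < ‖curl (u t) x‖ * d t x := mul_pos (norm_pos_iff.2 (hcurl x hx)) hdx
    linarith
  -- so `W ⊆ {d < δ} ∩ B_ρ` for every `δ ∈ (0, ρ)`, and `vol W ≤ C₀ δ² ρ → 0`
  have hle : ∀ δ ∈ Ioo 0 ρ, volume W ≤ ENNReal.ofReal (C₀ * δ ^ 2 * ρ) := by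
    intro δ hδ
    refine (measure_mono fun x hx => ?_).trans (h.2.2.2.1 t ht δ hδ)
    exact ⟨(hd x hx).trans_lt hδ.1, hUB (hWU hx)⟩
  have hρ : 0 < ρ := h.1
  have htend : Tendsto (fun δ : ℝ => ENNReal.ofReal (C₀ * δ ^ 2 * ρ)) (𝓝[>] 0) (𝓝 0) := by
    have hc : Continuous fun δ : ℝ => ENNReal.ofReal (C₀ * δ ^ 2 * ρ) :=
      ENNReal.continuous_ofReal.comp (by fun_prop)
    have := (hc.tendsto 0).mono_left (nhdsWithin_le_nhds (s := Ioi (0 : ℝ)))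
    simpa using this
  have hev : ∀ᶠ δ in 𝓝[>] (0 : ℝ), volume W ≤ ENNReal.ofReal (C₀ * δ ^ 2 * ρ) := by
    filter_upwards [Ioo_mem_nhdsGT hρ] with δ hδ using hle δ hδ
  have hzero : volume W ≤ 0 := ge_of_tendsto htend hev
  exact (hW.measure_pos volume hWne).ne' (nonpos_iff_eq_zero.1 hzero)

/-- **A dense vortex line in one time slice kills every flat swirl gauge on the cylinder**: a gauge is in
particular a kinematic vortex chart (`isVortexChartOn_of_gauge`), so
`not_isVortexChartOn_of_dense_vortexLine` applies — only the kinematic clauses of the gauge are used.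
[folklore] -/
theorem not_isFlatSwirlGaugeOn_of_dense_vortexLine {t : ℝ} (ht : t ∈ Ioo (T - ρ ^ 2) T)
    {U : Set ℝ³} (hU : IsOpen U) (hUB : U ⊆ ball x₀ ρ) {γ : ℝ → ℝ³}
    (hγ : ∀ s, HasDerivAt γ (curl (u t) (γ s)) s) (hγU : ∀ s, γ s ∈ U)
    (hdense : U ⊆ closure (range γ)) {W : Set ℝ³} (hW : IsOpen W) (hWne : W.Nonempty) (hWU : W ⊆ U)
    (hcurl : ∀ x ∈ W, curl (u t) x ≠ 0) : ¬ IsFlatSwirlGaugeOn ν u T x₀ ρ C₀ M α b d :=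
  fun h => not_isVortexChartOn_of_dense_vortexLine ht hU hUB hγ hγU hdense hW hWne hWU hcurl
    (isVortexChartOn_of_gauge h)

/-- **Dense vortex lines inside every backward cylinder at `(T, x₀)` exclude a flat swirl gauge there.**
If for every radius `ρ` with `0 < ρ`, `ρ² < T` some time slice `t ∈ (T − ρ², T)` of `Q_ρ(T, x₀)` carries a
vortex line confined to and dense in an open `U ⊆ B_ρ(x₀)`, with `curl (u t) ≠ 0` on an open nonempty
`W ⊆ U`, then `¬ HasFlatSwirlGauge ν u T x₀`. [folklore] -/
theorem not_hasFlatSwirlGauge_of_dense_vortexLines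
    (hdvl : ∀ ρ : ℝ, 0 < ρ → ρ ^ 2 < T → ∃ t ∈ Ioo (T - ρ ^ 2) T, ∃ U : Set ℝ³, IsOpen U ∧
      U ⊆ ball x₀ ρ ∧ ∃ γ : ℝ → ℝ³, (∀ s, HasDerivAt γ (curl (u t) (γ s)) s) ∧ (∀ s, γ s ∈ U) ∧
      U ⊆ closure (range γ) ∧ ∃ W : Set ℝ³, IsOpen W ∧ W.Nonempty ∧ W ⊆ U ∧
      ∀ x ∈ W, curl (u t) x ≠ 0) :
    ¬ HasFlatSwirlGauge ν u T x₀ := by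
  rintro ⟨ρ, C₀, M, α, b, d, hg⟩
  obtain ⟨t, ht, U, hU, hUB, γ, hγ, hγU, hdense, W, hW, hWne, hWU, hcurl⟩ :=
    hdvl ρ hg.radius_pos hg.sq_radius_lt
  exact not_isFlatSwirlGaugeOn_of_dense_vortexLine ht hU hUB hγ hγU hdense hW hWne hWU hcurl hg

end Gauge

/-! ### The crux is false modulo a blow-up with dense vortex lines -/

/-- **`FlatGaugeAtSingularity` is false modulo `DenseVortexLinesAtSingularity`.** The hypothesis (written
inline; it is NOT constructible today — it contains a finite-time blow-up of a Leray–Hopf classical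
solution): some `ν > 0`, `T > 0`, a classical Navier–Stokes solution `(u, p)` on `ℝ³ × [0, T)` which is
Leray–Hopf from a rapidly decaying datum, a point `x₀` at which `u` is unbounded on every backward cylinder
(a singular point), and, inside every backward cylinder `Q_ρ(T, x₀)`, a time slice with a vortex line
dense in an open subset `U` of `B_ρ(x₀)` on which the vorticity does not vanish identically (persistent
topological transitivity of the frozen-time vortex-line flow down to the singular point — the "chaotic
(ABC-type) vortex lines" of the crux's `why it might fail`, DombreEtAl1986 / ArnoldKhesin1998 Ch. II).
Conclusion: `¬ FlatGaugeAtSingularity` — FG would hand this solution a flat swirl gauge at `(T, x₀)`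
(`hasFlatSwirlGauge_iff`), which `not_hasFlatSwirlGauge_of_dense_vortexLines` excludes. So any proof of
the crux (indeed of its kinematic stub K) must show that NO singularity has this vortex-line topology.
[folklore] -/
theorem flatGaugeAtSingularity_false_of_denseVortexLines
    (H : ∃ (ν T : ℝ) (u : ℝ → ℝ³ → ℝ³) (p : ℝ → ℝ³ → ℝ) (x₀ : ℝ³), 0 < ν ∧ 0 < T ∧
      IsClassicalNSSolutionOn (Set.Ico 0 T) ν 0 u p ∧ IsLerayHopfOn T ν 0 (u 0) u ∧
      HasRapidSpatialDecay (u 0) ∧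
      ¬ (∃ r : ℝ, 0 < r ∧ ∃ K : ℝ, ∀ t ∈ Set.Ioo (T - r ^ 2) T, 0 ≤ t →
          ∀ x ∈ Metric.ball x₀ r, ‖u t x‖ ≤ K) ∧
      ∀ ρ : ℝ, 0 < ρ → ρ ^ 2 < T → ∃ t ∈ Ioo (T - ρ ^ 2) T, ∃ U : Set ℝ³, IsOpen U ∧
        U ⊆ ball x₀ ρ ∧ ∃ γ : ℝ → ℝ³, (∀ s, HasDerivAt γ (curl (u t) (γ s)) s) ∧ (∀ s, γ s ∈ U) ∧
        U ⊆ closure (range γ) ∧ ∃ y ∈ U, curl (u t) y ≠ 0) :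
    ¬ FlatGaugeAtSingularity := by
  intro hFG
  obtain ⟨ν, T, u, p, x₀, hν, hT, hcl, hLH, hdec, hsing, hdvl⟩ := H
  refine not_hasFlatSwirlGauge_of_dense_vortexLines (fun ρ hρ hρT => ?_)
    ((hasFlatSwirlGauge_iff ν u T x₀).2 (hFG ν T hν hT u p hcl hLH hdec x₀ hsing))
  obtain ⟨t, ht, U, hU, hUB, γ, hγ, hγU, hdense, y, hyU, hy⟩ := hdvl ρ hρ hρT
  -- the vorticity of the classical solution is continuous at the interior time `t`, so it is
  -- nonvanishing on the open neighbourhood `W = U ∩ {curl (u t) ≠ 0}` of `y`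
  have ht0 : t ∈ Ico 0 T := ⟨by nlinarith [ht.1], ht.2⟩
  have hcont : Continuous (curl (u t)) :=
    continuous_curl ((hcl.contDiff_velocity ht0).of_le (by exact_mod_cast le_top))
  refine ⟨t, ht, U, hU, hUB, γ, hγ, hγU, hdense, U ∩ {x | curl (u t) x ≠ 0},
    hU.inter (isOpen_ne.preimage hcont), ⟨y, hyU, hy⟩, inter_subset_left, fun x hx => hx.2⟩

/-! ### Refutability: `¬ FlatGaugeAtSingularity` would exhibit a blow-up -/

/-- **`FlatGaugeAtSingularity` follows from "no blow-up".** If every Leray–Hopf classical solution on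
`ℝ³ × [0, T)` from a rapidly decaying datum extends smoothly past `T` (the antecedent of the route's
`NoBlowupToClay`, i.e. the standard reformulation of Clay (A)), then FG holds VACUOUSLY: the extension
`u'` is jointly continuous on `[0, T] × B̄₁(x₀)`, hence bounded there, and agrees with `u` on `[0, T)`, so
no point `(T, x₀)` is singular. Contrapositive: any refutation of the crux exhibits a finite-time blow-up
(`¬ NoBlowup`), i.e. FG is irrefutable short of a negative answer to the Millennium problem — which is why
the obstruction above is only a negative-MODULO lemma. [folklore] -/
theorem flatGaugeAtSingularity_of_noBlowup
    (hNB : ∀ (ν T : ℝ), 0 < ν → 0 < T → ∀ (u : ℝ → ℝ³ → ℝ³) (p : ℝ → ℝ³ → ℝ),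
      IsClassicalNSSolutionOn (Set.Ico 0 T) ν 0 u p → IsLerayHopfOn T ν 0 (u 0) u →
      HasRapidSpatialDecay (u 0) → HasSmoothExtensionPast ν 0 u T) :
    FlatGaugeAtSingularity := by
  intro ν T hν hT u p hcl hLH hdec x₀ hsing
  obtain ⟨T', hT'T, u', p', hcl', hagree⟩ := hNB ν T hν hT u p hcl hLH hdec
  exfalso
  apply hsing
  -- `u'` is continuous on the compact set `[0, T] × closedBall x₀ 1`, hence bounded there
  have hK : IsCompact (Icc 0 T ×ˢ closedBall x₀ (1 : ℝ)) :=
    isCompact_Icc.prod (isCompact_closedBall x₀ 1)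
  have hcont : ContinuousOn (uncurry u') (Icc 0 T ×ˢ closedBall x₀ (1 : ℝ)) :=
    hcl'.smooth_velocity.continuousOn.mono
      (prod_mono (fun t ht => ⟨ht.1, ht.2.trans_lt hT'T⟩) (subset_univ _))
  obtain ⟨K, hKb⟩ := hK.exists_bound_of_continuousOn hcont
  refine ⟨1, one_pos, K, fun t ht h0t x hx => ?_⟩
  have htx : (t, x) ∈ Icc 0 T ×ˢ closedBall x₀ (1 : ℝ) :=
    mk_mem_prod ⟨h0t, ht.2.le⟩ (ball_subset_closedBall hx)
  have heq : u t x = u' t x := by rw [hagree t ⟨h0t, ht.2⟩]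
  rw [heq]
  exact hKb (t, x) htx

/-- **Contrapositive**: a refutation of `FlatGaugeAtSingularity` yields a Leray–Hopf classical solution
from a rapidly decaying datum with NO smooth extension past its time `T` — a finite-time blow-up.
[folklore] -/
theorem exists_blowup_of_not_flatGaugeAtSingularity (h : ¬ FlatGaugeAtSingularity) :
    ∃ (ν T : ℝ) (u : ℝ → ℝ³ → ℝ³) (p : ℝ → ℝ³ → ℝ), 0 < ν ∧ 0 < T ∧
      IsClassicalNSSolutionOn (Set.Ico 0 T) ν 0 u p ∧ IsLerayHopfOn T ν 0 (u 0) u ∧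
      HasRapidSpatialDecay (u 0) ∧ ¬ HasSmoothExtensionPast ν 0 u T := by
  by_contra hne
  push Not at hne
  exact h (flatGaugeAtSingularity_of_noBlowup fun ν T hν hT u p hcl hLH hdec =>
    hne ν T u p hν hT hcl hLH hdec)

end Summit.NavierStokesRegularity.NavierStokesRegularity.Theorems.FlatGaugeAtSingularity.Negative

end
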